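import Summits.CriticalPhenomena.PercolationContinuityZ3.Theorems.PercNearOneGluingNoHeavyLowerTailAPLFamilyAll
import Summits.CriticalPhenomena.PercolationContinuityZ3.Theorems.PercNearOneGluingNoHeavyLowerTailAPLFamilyRay
import Summits.CriticalPhenomena.PercolationContinuityZ3.Theorems.PercNearOneGluingNoHeavyLowerTailAPLGeometricClosure
import Summits.CriticalPhenomena.PercolationContinuityZ3.Theorems.PercNearOneGluingNoHeavyLowerTailAPLTwoThirdsAll
import Literature.Probability.LatticeModels.ProdBernoulliIndependence
import HarnessLib

/-!
# `NoHeavyLowerTail` (stmt-CriticalPhenomena-4575) — APL-G `(T·D − e)² ≤ P(ab|c)·P(ac|b)` FOR EVERY FINITE WEIGHTED GRAPH, and the quantitative Gladkov–Zimin Conjecture 6.3 on all graphs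

Support file (prover prim-ineq-gen-8 gen 38; `--supports stmt-CriticalPhenomena-4575`; memo
run/shared/lean/prim/prim-ineq-gen-8/FINDING-gen38-APLG-ALL.md THEOREM 2 / COROLLARY 3).  No definitions, no named facts, no sorries.

`μ = prodBernoulli w` on the pairs of a finite vertex type `V`; cells `u0 = μ(a|b|c)`, `uab = μ(ab|c)`, `uac = μ(ac|b)`, `ubc = μ(a|bc)`,
`u3 = μ(a↔b, a↔c)`; `T = μ(a↔b ∨ a↔c) = uab+uac+u3`, `D = μ(b↮c) = u0+uab+uac`, `e = uab+uac`.
* `harris_TD` — Harris: `e ≤ T·D`;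
* **`aplG_all`** — gen 29's GEOMETRIC row APL-G for EVERY finite weighted graph: **`(T·D − e)² ≤ uab·uac`**, i.e.
  `Cov(1[a↔{b,c}], 1[b↔c])² ≤ P(ab|c)·P(ac|b)` (the 2×2 matrix `[[P(ab|c), TD−e],[TD−e, P(ac|b)]]` is positive semidefinite).
  Proof: the admissible family of profile rows (`family_all`) at the member `s = sqrt(8λ+1)` gives the λ-row `2(TD−e) ≤ λ·uab + uac/λ`
  for every `λ ≥ 1` (`lambdaRow_of_member`), and for `λ ≤ 1` through the instance `(a; c, b)`; then `λ = (TD−e)/uab`;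
* `aplG_all_events`, `aplG_all_sqrt` — the same with `T = μ(openConn a b ∪ openConn a c)`, `D = μ((openConn b c)ᶜ)`, resp. as `T·D − e ≤ sqrt(uab·uac)`;
* **`gz63_all`** — the QUANTITATIVE Gladkov–Zimin Conjecture 6.3 (Gladkov–Zimin, ECP 2026, arXiv:2404.08873, Conj. 6.3 = Gladkov arXiv:2408.08457
  Conj. 10.1) for EVERY finite weighted graph: `μ(a↔b, a↔c) − μ(a↔c)·μ(b↔c) ≤ sqrt(μ(ab|c)·μ(ac|b)) + μ(ab|c)·μ(b↔c)`, so
  `P(ab|c) < δ ⟹ P(abc) − P(ac)P(bc) < √δ + δ` (gen 36's `gz63_forest` without the forest hypothesis);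
* `gz62_all` — APL-G in cells `P(a|b|c)P(abc) ≤ (P(ab|c)+P(ac|b))P(a|bc) + sqrt(P(ab|c)P(ac|b))`, the quantitative form of Gladkov–Zimin Conj. 6.2;
* **`gladkovZimin_conjecture_6_3`** — the conjecture VERBATIM: `∀ ε > 0 ∃ δ > 0` (`δ = min(1, ε²/4)`) `∀ w a b c: P(ab|c) < δ → P(abc) − P(ac)P(bc) < ε`.
[this work]
-/

noncomputable section

namespace Summit.CriticalPhenomena.PercolationContinuityZ3.Theorems

namespace APL

open MeasureTheory Set Literature.Probability.Percolation Literature.Probability.LatticeModels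
open Literature.Probability.Percolation.KNPreFKG (openConn_symm)
open scoped Classical

variable {V : Type*} [Fintype V]

universe u

/-! ### Harris in cells -/

/-- `μ((a↔b ∨ a↔c) ∧ b↮c) = μ(ab|c) + μ(ac|b)`. [folklore] -/
theorem real_T_inter_D_eq_cells (w : Sym2 V → unitInterval) (a b c : V) :
    (prodBernoulli w).real ((openConn a b ∪ openConn a c : Set (BondConfig V)) ∩ (openConn b c : Set (BondConfig V))ᶜ) =
      (prodBernoulli w).real (openConn a b ∩ (openConn a c)ᶜ : Set (BondConfig V))
        + (prodBernoulli w).real (openConn a c ∩ (openConn a b)ᶜ : Set (BondConfig V)) := by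
  have h := ClusterCovTransfer.real_eq_inter_add_inter_compl w
    ((openConn a b ∪ openConn a c : Set (BondConfig V)) ∩ (openConn b c : Set (BondConfig V))ᶜ) (openConn a b : Set (BondConfig V))
  have e1 : (openConn a b ∪ openConn a c : Set (BondConfig V)) ∩ (openConn b c : Set (BondConfig V))ᶜ ∩ (openConn a b : Set (BondConfig V))
      = (openConn a b ∩ (openConn a c)ᶜ : Set (BondConfig V)) := by
    ext ω
    simp only [mem_inter_iff, mem_union, mem_compl_iff]
    constructor
    · rintro ⟨⟨_, hbc⟩, hab⟩
      exact ⟨hab, fun hac => hbc (SimpleGraph.Reachable.trans (SimpleGraph.Reachable.symm hab) hac)⟩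
    · rintro ⟨hab, hac⟩
      exact ⟨⟨Or.inl hab, fun hbc => hac (SimpleGraph.Reachable.trans hab hbc)⟩, hab⟩
  have e2 : (openConn a b ∪ openConn a c : Set (BondConfig V)) ∩ (openConn b c : Set (BondConfig V))ᶜ ∩ (openConn a b : Set (BondConfig V))ᶜ
      = (openConn a c ∩ (openConn a b)ᶜ : Set (BondConfig V)) := by
    ext ω
    simp only [mem_inter_iff, mem_union, mem_compl_iff]
    constructor
    · rintro ⟨⟨h, _⟩, hab⟩
      rcases h with h | h
      · exact absurd h hab
      · exact ⟨h, hab⟩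
    · rintro ⟨hac, hab⟩
      exact ⟨⟨Or.inr hac, fun hbc => hab (SimpleGraph.Reachable.trans hac (SimpleGraph.Reachable.symm hbc))⟩, hab⟩
  rw [e1, e2] at h
  exact h

/-- **Harris in cells**: `e ≤ T·D`, i.e. `uab + uac ≤ (uab+uac+u3)·(u0+uab+uac)` (the increasing event `{a↔b ∨ a↔c}` and the
decreasing event `{b↮c}`). [folklore] -/
theorem harris_TD (w : Sym2 V → unitInterval) (a b c : V) :
    (prodBernoulli w).real (openConn a b ∩ (openConn a c)ᶜ : Set (BondConfig V))
        + (prodBernoulli w).real (openConn a c ∩ (openConn a b)ᶜ : Set (BondConfig V)) ≤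
      ((prodBernoulli w).real (openConn a b ∩ (openConn a c)ᶜ : Set (BondConfig V))
          + (prodBernoulli w).real (openConn a c ∩ (openConn a b)ᶜ : Set (BondConfig V))
          + (prodBernoulli w).real (openConn a b ∩ openConn a c : Set (BondConfig V))) *
        ((prodBernoulli w).real ((openConn a b)ᶜ ∩ (openConn a c)ᶜ ∩ (openConn b c)ᶜ : Set (BondConfig V))
          + (prodBernoulli w).real (openConn a b ∩ (openConn a c)ᶜ : Set (BondConfig V))
          + (prodBernoulli w).real (openConn a c ∩ (openConn a b)ᶜ : Set (BondConfig V))) := by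
  have hup : IsUpperSet (openConn a b ∪ openConn a c : Set (BondConfig V)) :=
    (isUpperSet_openConn a b).union (isUpperSet_openConn a c)
  have hlow : IsLowerSet ((openConn b c : Set (BondConfig V))ᶜ) := (isUpperSet_openConn b c).compl
  have hH := prodBernoulli_harris_upper_lower w hup hlow MeasurableSet.of_discrete MeasurableSet.of_discrete
  rw [real_T_inter_D_eq_cells, real_conn_ab_or_ac_eq_cells w a b c, real_notConn_bc_eq_cells w a b c] at hH
  exact hH

/-! ### APL-G for every finite weighted graph -/

/-- Bookkeeping for `λ < 1`: if `H > 0`, `p > 0` and `2H ≤ (p/H)·q + p/(p/H)` then `H² ≤ p·q`. [folklore] -/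
theorem sq_le_of_lambdaRow' (H p q : ℝ) (hH : 0 < H) (hp : 0 < p)
    (h : 2 * H ≤ p / H * q + p / (p / H)) : H ^ 2 ≤ p * q := by
  have e2 : p / (p / H) = H := by field_simp
  rw [e2] at h
  have h3 : H ≤ p / H * q := by linarith
  rw [div_mul_eq_mul_div, le_div_iff₀ hH] at h3
  nlinarith

set_option maxHeartbeats 1600000 in
/-- **APL-G FOR EVERY FINITE WEIGHTED GRAPH** (memo THEOREM 2; gen 29's geometric row, conjectured for all graphs since gen 29 and proved
there on forests): in cells, `((uab+uac+u3)(u0+uab+uac) − (uab+uac))² ≤ uab·uac`, i.e. `(T·D − e)² ≤ P(ab|c)·P(ac|b)`.  Via the admissible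
family of profile rows (`family_all`) and the ray-convexity lemma (`lambdaRow_of_member`). [this work] -/
theorem aplG_all (w : Sym2 V → unitInterval) (a b c : V) :
    (((prodBernoulli w).real (openConn a b ∩ (openConn a c)ᶜ : Set (BondConfig V))
          + (prodBernoulli w).real (openConn a c ∩ (openConn a b)ᶜ : Set (BondConfig V))
          + (prodBernoulli w).real (openConn a b ∩ openConn a c : Set (BondConfig V))) *
        ((prodBernoulli w).real ((openConn a b)ᶜ ∩ (openConn a c)ᶜ ∩ (openConn b c)ᶜ : Set (BondConfig V))
          + (prodBernoulli w).real (openConn a b ∩ (openConn a c)ᶜ : Set (BondConfig V))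
          + (prodBernoulli w).real (openConn a c ∩ (openConn a b)ᶜ : Set (BondConfig V)))
      - ((prodBernoulli w).real (openConn a b ∩ (openConn a c)ᶜ : Set (BondConfig V))
          + (prodBernoulli w).real (openConn a c ∩ (openConn a b)ᶜ : Set (BondConfig V)))) ^ 2 ≤
    (prodBernoulli w).real (openConn a b ∩ (openConn a c)ᶜ : Set (BondConfig V))
      * (prodBernoulli w).real (openConn a c ∩ (openConn a b)ᶜ : Set (BondConfig V)) := by
  set u0 := (prodBernoulli w).real ((openConn a b)ᶜ ∩ (openConn a c)ᶜ ∩ (openConn b c)ᶜ : Set (BondConfig V)) with hu0def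
  set uab := (prodBernoulli w).real (openConn a b ∩ (openConn a c)ᶜ : Set (BondConfig V)) with huabdef
  set uac := (prodBernoulli w).real (openConn a c ∩ (openConn a b)ᶜ : Set (BondConfig V)) with huacdef
  set ubc := (prodBernoulli w).real ((openConn a b)ᶜ ∩ (openConn a c)ᶜ ∩ openConn b c : Set (BondConfig V)) with hubcdef
  set u3 := (prodBernoulli w).real (openConn a b ∩ openConn a c : Set (BondConfig V)) with hu3def
  have hu0 : 0 ≤ u0 := measureReal_nonneg
  have huab : 0 ≤ uab := measureReal_nonneg
  have huac : 0 ≤ uac := measureReal_nonneg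
  have hubc : 0 ≤ ubc := measureReal_nonneg
  have hu3 : 0 ≤ u3 := measureReal_nonneg
  have hsum : u0 + uab + uac + ubc + u3 = 1 := prodBernoulli_cells_sum_eq_one w a b c
  have hHar := harris_TD w a b c
  -- the Harris defect `H = TD − e = u0 − (u0+ubc)·D`
  set H := (uab + uac + u3) * (u0 + uab + uac) - (uab + uac) with hHdef
  have hH0 : 0 ≤ H := by rw [hHdef]; linarith
  have eH : H = u0 - (u0 + ubc) * (u0 + uab + uac) := by
    rw [hHdef]; linear_combination (u0 + uab + uac) * hsum
  -- the rows of the family, in both orientations, for the member serving `λ ≥ 1`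
  have row : ∀ lam : ℝ, 1 ≤ lam →
      u0 ^ ((Real.sqrt (8 * lam + 1) ^ 2 + 3) / (2 * (Real.sqrt (8 * lam + 1) + 1))
          + (Real.sqrt (8 * lam + 1) ^ 2 + 3) / (Real.sqrt (8 * lam + 1) ^ 2 - 1))
        ≤ (u0 + ubc) * (u0 + uac) ^ ((Real.sqrt (8 * lam + 1) ^ 2 + 3) / (Real.sqrt (8 * lam + 1) ^ 2 - 1))
          * (u0 + uab) ^ ((Real.sqrt (8 * lam + 1) ^ 2 + 3) / (2 * (Real.sqrt (8 * lam + 1) + 1))) ∧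
      u0 ^ ((Real.sqrt (8 * lam + 1) ^ 2 + 3) / (2 * (Real.sqrt (8 * lam + 1) + 1))
          + (Real.sqrt (8 * lam + 1) ^ 2 + 3) / (Real.sqrt (8 * lam + 1) ^ 2 - 1))
        ≤ (u0 + ubc) * (u0 + uab) ^ ((Real.sqrt (8 * lam + 1) ^ 2 + 3) / (Real.sqrt (8 * lam + 1) ^ 2 - 1))
          * (u0 + uac) ^ ((Real.sqrt (8 * lam + 1) ^ 2 + 3) / (2 * (Real.sqrt (8 * lam + 1) + 1))) := by
    intro lam hlam
    obtain ⟨hs, _⟩ := fam_param_of_lambda lam hlam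
    obtain ⟨hα, hβ, hadm, _, _⟩ := fam_member (Real.sqrt (8 * lam + 1)) hs
    refine ⟨?_, ?_⟩
    · have r := family_all _ _ hα hβ hadm w a b c
      rw [isoA_split, isoB_split, isoC_split] at r
      exact r
    · have r := family_all _ _ hα hβ hadm w a c b
      rw [openConn_symm c b] at r
      rw [Set.inter_comm ((openConn a c : Set (BondConfig V))ᶜ) ((openConn a b : Set (BondConfig V))ᶜ)] at r
      rw [isoA_split, isoB_split, isoC_split] at r
      exact r
  -- `H = 0` is trivial; otherwise `u0 > 0`
  rcases eq_or_lt_of_le hH0 with hH | hH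
  · rw [← hH]; simpa using mul_nonneg huab huac
  have hu0' : 0 < u0 := by
    rcases eq_or_lt_of_le hu0 with h | h
    · exfalso
      have : H ≤ 0 := by
        rw [eH, ← h]
        have : 0 ≤ ubc * (uab + uac) := mul_nonneg hubc (add_nonneg huab huac)
        nlinarith
      linarith
    · exact h
  -- the λ-rows
  have lamRow : ∀ lam : ℝ, 1 ≤ lam → 2 * H ≤ lam * uab + uac / lam := by
    intro lam hlam
    rw [eH]
    exact lambdaRow_of_member lam u0 uab uac ubc hlam hu0' huab huac (row lam hlam).1
  have lamRow' : ∀ lam : ℝ, 1 ≤ lam → 2 * H ≤ lam * uac + uab / lam := by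
    intro lam hlam
    have e : u0 - (u0 + ubc) * (u0 + uab + uac) = u0 - (u0 + ubc) * (u0 + uac + uab) := by ring
    rw [eH, e]
    exact lambdaRow_of_member lam u0 uac uab ubc hlam hu0' huac huab (row lam hlam).2
  -- conclude
  rcases eq_or_lt_of_le huab with hab0 | hab0
  · -- `uab = 0`: the λ-rows force `H ≤ uac/(2λ)` for every `λ ≥ 1`, contradicting `H > 0`
    exfalso
    rcases eq_or_lt_of_le huac with hac0 | hac0
    · have := lamRow 1 le_rfl
      rw [← hab0, ← hac0] at this
      norm_num at this
      linarith
    · have h1 : 1 ≤ uac / H + 1 := by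
        have : 0 ≤ uac / H := div_nonneg huac hH.le
        linarith
      have := lamRow (uac / H + 1) h1
      rw [← hab0, mul_zero, zero_add] at this
      have hlt : uac / (uac / H + 1) < uac / (uac / H) :=
        div_lt_div_of_pos_left hac0 (div_pos hac0 hH) (by linarith)
      have e3 : uac / (uac / H) = H := by field_simp
      rw [e3] at hlt
      linarith
  · by_cases hcase : 1 ≤ H / uab
    · exact sq_le_of_lambdaRow H uab uac hH hab0 (lamRow (H / uab) hcase)
    · push Not at hcase
      have h1 : 1 ≤ uab / H := by
        rw [le_div_iff₀ hH]
        rw [div_lt_one hab0] at hcase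
        linarith
      exact sq_le_of_lambdaRow' H uab uac hH hab0 (by simpa [mul_comm] using lamRow' (uab / H) h1)

/-- **APL-G, event form**: `(μ(a↔b ∨ a↔c)·μ(b↮c) − (μ(ab|c)+μ(ac|b)))² ≤ μ(ab|c)·μ(ac|b)` for every finite weighted graph. [this work] -/
theorem aplG_all_events (w : Sym2 V → unitInterval) (a b c : V) :
    ((prodBernoulli w).real (openConn a b ∪ openConn a c : Set (BondConfig V))
        * (prodBernoulli w).real ((openConn b c : Set (BondConfig V))ᶜ)
      - ((prodBernoulli w).real (openConn a b ∩ (openConn a c)ᶜ : Set (BondConfig V))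
          + (prodBernoulli w).real (openConn a c ∩ (openConn a b)ᶜ : Set (BondConfig V)))) ^ 2 ≤
    (prodBernoulli w).real (openConn a b ∩ (openConn a c)ᶜ : Set (BondConfig V))
      * (prodBernoulli w).real (openConn a c ∩ (openConn a b)ᶜ : Set (BondConfig V)) := by
  rw [real_conn_ab_or_ac_eq_cells w a b c, real_notConn_bc_eq_cells w a b c]
  exact aplG_all w a b c

/-- **APL-G, square-root form**: `μ(a↔b ∨ a↔c)·μ(b↮c) − (μ(ab|c)+μ(ac|b)) ≤ sqrt(μ(ab|c)·μ(ac|b))`. [this work] -/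
theorem aplG_all_sqrt (w : Sym2 V → unitInterval) (a b c : V) :
    (prodBernoulli w).real (openConn a b ∪ openConn a c : Set (BondConfig V))
        * (prodBernoulli w).real ((openConn b c : Set (BondConfig V))ᶜ)
      - ((prodBernoulli w).real (openConn a b ∩ (openConn a c)ᶜ : Set (BondConfig V))
          + (prodBernoulli w).real (openConn a c ∩ (openConn a b)ᶜ : Set (BondConfig V))) ≤
    Real.sqrt ((prodBernoulli w).real (openConn a b ∩ (openConn a c)ᶜ : Set (BondConfig V))
      * (prodBernoulli w).real (openConn a c ∩ (openConn a b)ᶜ : Set (BondConfig V))) := by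
  have h := aplG_all_events w a b c
  calc _ ≤ |(prodBernoulli w).real (openConn a b ∪ openConn a c : Set (BondConfig V))
        * (prodBernoulli w).real ((openConn b c : Set (BondConfig V))ᶜ)
      - ((prodBernoulli w).real (openConn a b ∩ (openConn a c)ᶜ : Set (BondConfig V))
          + (prodBernoulli w).real (openConn a c ∩ (openConn a b)ᶜ : Set (BondConfig V)))| := le_abs_self _
    _ = Real.sqrt (((prodBernoulli w).real (openConn a b ∪ openConn a c : Set (BondConfig V))
        * (prodBernoulli w).real ((openConn b c : Set (BondConfig V))ᶜ)
      - ((prodBernoulli w).real (openConn a b ∩ (openConn a c)ᶜ : Set (BondConfig V))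
          + (prodBernoulli w).real (openConn a c ∩ (openConn a b)ᶜ : Set (BondConfig V)))) ^ 2) :=
      (Real.sqrt_sq_eq_abs _).symm
    _ ≤ _ := Real.sqrt_le_sqrt h

/-! ### The quantitative Gladkov–Zimin conjecture for every finite weighted graph -/

/-- **Quantitative Gladkov–Zimin Conjecture 6.3 / Gladkov Conjecture 10.1 FOR EVERY FINITE WEIGHTED GRAPH** (memo COROLLARY 3):
`μ(a↔b, a↔c) − μ(a↔c)·μ(b↔c) ≤ sqrt(μ(ab|c)·μ(ac|b)) + μ(ab|c)·μ(b↔c)`; in particular `P(ab|c) < δ` forces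
`P(abc) − P(ac)P(bc) < √δ + δ`.  (Gen 36's `gz63_forest` without the forest hypothesis.) [this work] -/
theorem gz63_all (w : Sym2 V → unitInterval) (a b c : V) :
    (prodBernoulli w).real (openConn a b ∩ openConn a c : Set (BondConfig V))
      - ((prodBernoulli w).real (openConn a c ∩ (openConn a b)ᶜ : Set (BondConfig V))
          + (prodBernoulli w).real (openConn a b ∩ openConn a c : Set (BondConfig V)))
        * ((prodBernoulli w).real ((openConn a b)ᶜ ∩ (openConn a c)ᶜ ∩ openConn b c : Set (BondConfig V))
          + (prodBernoulli w).real (openConn a b ∩ openConn a c : Set (BondConfig V))) ≤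
      Real.sqrt ((prodBernoulli w).real (openConn a b ∩ (openConn a c)ᶜ : Set (BondConfig V))
          * (prodBernoulli w).real (openConn a c ∩ (openConn a b)ᶜ : Set (BondConfig V)))
        + (prodBernoulli w).real (openConn a b ∩ (openConn a c)ᶜ : Set (BondConfig V))
          * ((prodBernoulli w).real ((openConn a b)ᶜ ∩ (openConn a c)ᶜ ∩ openConn b c : Set (BondConfig V))
            + (prodBernoulli w).real (openConn a b ∩ openConn a c : Set (BondConfig V))) :=
  gz63_of_geom _ _ _ _ _ (prodBernoulli_cells_sum_eq_one w a b c) (aplG_all w a b c)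


/-- **Quantitative Gladkov–Zimin Conjecture 6.2 FOR EVERY FINITE WEIGHTED GRAPH** (APL-G in cell form, memo §0):
`μ(a|b|c)·μ(a↔b,a↔c) ≤ (μ(ab|c)+μ(ac|b))·μ(a|bc) + sqrt(μ(ab|c)·μ(ac|b))`; so `P(ab|c), P(ac|b) < δ` forces `P(a|b|c)·P(abc) < 2δ + δ = 3δ`,
i.e. `min(P(a|b|c), P(abc)) < sqrt(3δ)` (Gladkov–Zimin, ECP 2026, Conj. 6.2, quantitatively). [this work] -/
theorem gz62_all (w : Sym2 V → unitInterval) (a b c : V) :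
    (prodBernoulli w).real ((openConn a b)ᶜ ∩ (openConn a c)ᶜ ∩ (openConn b c)ᶜ : Set (BondConfig V))
        * (prodBernoulli w).real (openConn a b ∩ openConn a c : Set (BondConfig V)) ≤
      ((prodBernoulli w).real (openConn a b ∩ (openConn a c)ᶜ : Set (BondConfig V))
          + (prodBernoulli w).real (openConn a c ∩ (openConn a b)ᶜ : Set (BondConfig V)))
        * (prodBernoulli w).real ((openConn a b)ᶜ ∩ (openConn a c)ᶜ ∩ openConn b c : Set (BondConfig V))
      + Real.sqrt ((prodBernoulli w).real (openConn a b ∩ (openConn a c)ᶜ : Set (BondConfig V))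
          * (prodBernoulli w).real (openConn a c ∩ (openConn a b)ᶜ : Set (BondConfig V))) := by
  have h := aplG_all w a b c
  rw [harrisDefect_eq_cells _ _ _ _ _ (prodBernoulli_cells_sum_eq_one w a b c)] at h
  have h1 : (prodBernoulli w).real ((openConn a b)ᶜ ∩ (openConn a c)ᶜ ∩ (openConn b c)ᶜ : Set (BondConfig V))
        * (prodBernoulli w).real (openConn a b ∩ openConn a c : Set (BondConfig V))
      - ((prodBernoulli w).real (openConn a b ∩ (openConn a c)ᶜ : Set (BondConfig V))
          + (prodBernoulli w).real (openConn a c ∩ (openConn a b)ᶜ : Set (BondConfig V)))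
        * (prodBernoulli w).real ((openConn a b)ᶜ ∩ (openConn a c)ᶜ ∩ openConn b c : Set (BondConfig V)) ≤
      Real.sqrt ((prodBernoulli w).real (openConn a b ∩ (openConn a c)ᶜ : Set (BondConfig V))
          * (prodBernoulli w).real (openConn a c ∩ (openConn a b)ᶜ : Set (BondConfig V))) :=
    calc _ ≤ |(prodBernoulli w).real ((openConn a b)ᶜ ∩ (openConn a c)ᶜ ∩ (openConn b c)ᶜ : Set (BondConfig V))
        * (prodBernoulli w).real (openConn a b ∩ openConn a c : Set (BondConfig V))
      - ((prodBernoulli w).real (openConn a b ∩ (openConn a c)ᶜ : Set (BondConfig V))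
          + (prodBernoulli w).real (openConn a c ∩ (openConn a b)ᶜ : Set (BondConfig V)))
        * (prodBernoulli w).real ((openConn a b)ᶜ ∩ (openConn a c)ᶜ ∩ openConn b c : Set (BondConfig V))| := le_abs_self _
      _ = Real.sqrt (((prodBernoulli w).real ((openConn a b)ᶜ ∩ (openConn a c)ᶜ ∩ (openConn b c)ᶜ : Set (BondConfig V))
        * (prodBernoulli w).real (openConn a b ∩ openConn a c : Set (BondConfig V))
      - ((prodBernoulli w).real (openConn a b ∩ (openConn a c)ᶜ : Set (BondConfig V))
          + (prodBernoulli w).real (openConn a c ∩ (openConn a b)ᶜ : Set (BondConfig V)))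
        * (prodBernoulli w).real ((openConn a b)ᶜ ∩ (openConn a c)ᶜ ∩ openConn b c : Set (BondConfig V))) ^ 2) :=
        (Real.sqrt_sq_eq_abs _).symm
      _ ≤ _ := Real.sqrt_le_sqrt h
  linarith


/-- `μ(a↔c) = μ(ac|b) + μ(a↔b, a↔c)`. [folklore] -/
theorem real_conn_ac_eq_cells (w : Sym2 V → unitInterval) (a b c : V) :
    (prodBernoulli w).real (openConn a c : Set (BondConfig V)) =
      (prodBernoulli w).real (openConn a c ∩ (openConn a b)ᶜ : Set (BondConfig V))
        + (prodBernoulli w).real (openConn a b ∩ openConn a c : Set (BondConfig V)) := by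
  have h := ClusterCovTransfer.real_eq_inter_add_inter_compl w (openConn a c : Set (BondConfig V)) (openConn a b : Set (BondConfig V))
  rw [Set.inter_comm (openConn a c : Set (BondConfig V)) (openConn a b : Set (BondConfig V))] at h
  linarith

/-- `μ(b↔c) = μ(a|bc) + μ(a↔b, a↔c)`. [folklore] -/
theorem real_conn_bc_eq_cells (w : Sym2 V → unitInterval) (a b c : V) :
    (prodBernoulli w).real (openConn b c : Set (BondConfig V)) =
      (prodBernoulli w).real ((openConn a b)ᶜ ∩ (openConn a c)ᶜ ∩ openConn b c : Set (BondConfig V))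
        + (prodBernoulli w).real (openConn a b ∩ openConn a c : Set (BondConfig V)) := by
  have h := ClusterCovTransfer.real_eq_inter_add_inter_compl w (openConn b c : Set (BondConfig V)) (openConn a b : Set (BondConfig V))
  have e1 : (openConn b c : Set (BondConfig V)) ∩ (openConn a b : Set (BondConfig V)) = (openConn a b ∩ openConn a c : Set (BondConfig V)) := by
    ext ω
    simp only [mem_inter_iff]
    constructor
    · rintro ⟨hbc, hab⟩; exact ⟨hab, SimpleGraph.Reachable.trans hab hbc⟩
    · rintro ⟨hab, hac⟩; exact ⟨SimpleGraph.Reachable.trans (SimpleGraph.Reachable.symm hab) hac, hab⟩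
  have e2 : (openConn b c : Set (BondConfig V)) ∩ (openConn a b : Set (BondConfig V))ᶜ
      = ((openConn a b)ᶜ ∩ (openConn a c)ᶜ ∩ openConn b c : Set (BondConfig V)) := by
    ext ω
    simp only [mem_inter_iff, mem_compl_iff]
    constructor
    · rintro ⟨hbc, hab⟩
      exact ⟨⟨hab, fun hac => hab (SimpleGraph.Reachable.trans hac (SimpleGraph.Reachable.symm hbc))⟩, hbc⟩
    · rintro ⟨⟨hab, _⟩, hbc⟩; exact ⟨hbc, hab⟩
  rw [e1, e2] at h
  linarith

/-- **The Gladkov–Zimin Conjecture 6.3, verbatim** (Gladkov–Zimin, *Bond percolation does not simulate site percolation*, Electron. Commun.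
Probab. 31 (2026), arXiv:2404.08873, Conjecture 6.3; = Gladkov, arXiv:2408.08457, Conjecture 10.1): for every `ε > 0` there is `δ > 0`
(here `δ = min(1, ε²/4)`, uniformly in the graph) such that for EVERY finite vertex type, every weight function and all `a, b, c`:
`P(ab|c) < δ ⟹ P(abc) − P(ac)·P(bc) < ε`. [this work] -/
theorem gladkovZimin_conjecture_6_3 (ε : ℝ) (hε : 0 < ε) :
    ∃ δ : ℝ, 0 < δ ∧ ∀ (W : Type u) [Fintype W] (w : Sym2 W → unitInterval) (a b c : W),
      (prodBernoulli w).real (openConn a b ∩ (openConn a c)ᶜ : Set (BondConfig W)) < δ →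
        (prodBernoulli w).real (openConn a b ∩ openConn a c : Set (BondConfig W))
          - (prodBernoulli w).real (openConn a c : Set (BondConfig W)) * (prodBernoulli w).real (openConn b c : Set (BondConfig W)) < ε := by
  refine ⟨min 1 (ε ^ 2 / 4), lt_min zero_lt_one (by positivity), ?_⟩
  intro V _ w a b c hab
  have h := gz63_all w a b c
  rw [← real_conn_ac_eq_cells, ← real_conn_bc_eq_cells] at h
  set uab := (prodBernoulli w).real (openConn a b ∩ (openConn a c)ᶜ : Set (BondConfig V)) with huabdef
  set uac := (prodBernoulli w).real (openConn a c ∩ (openConn a b)ᶜ : Set (BondConfig V)) with huacdef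
  have huab : 0 ≤ uab := measureReal_nonneg
  have huac1 : uac ≤ 1 := measureReal_le_one
  have hbc1 : (prodBernoulli w).real (openConn b c : Set (BondConfig V)) ≤ 1 := measureReal_le_one
  have hδ1 : uab < 1 := lt_of_lt_of_le hab (min_le_left _ _)
  have hδ2 : uab < ε ^ 2 / 4 := lt_of_lt_of_le hab (min_le_right _ _)
  -- `sqrt(uab·uac) ≤ sqrt(uab) < ε/2` and `uab·P(bc) ≤ uab < ε/2`
  have h1 : Real.sqrt (uab * uac) < ε / 2 := by
    calc Real.sqrt (uab * uac) ≤ Real.sqrt uab := Real.sqrt_le_sqrt (by nlinarith)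
      _ < Real.sqrt (ε ^ 2 / 4) := Real.sqrt_lt_sqrt huab hδ2
      _ = ε / 2 := by
        rw [show ε ^ 2 / 4 = (ε / 2) ^ 2 by ring, Real.sqrt_sq (by linarith)]
  have h2 : uab * (prodBernoulli w).real (openConn b c : Set (BondConfig V)) < ε / 2 := by
    have : uab * (prodBernoulli w).real (openConn b c : Set (BondConfig V)) ≤ uab := by
      nlinarith [measureReal_nonneg (μ := prodBernoulli w) (s := (openConn b c : Set (BondConfig V)))]
    have hε2 : uab < ε / 2 := by
      rcases le_or_gt ε 2 with hle | hlt
      · nlinarith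
      · linarith
    linarith
  linarith

end APL

end Summit.CriticalPhenomena.PercolationContinuityZ3.Theorems

end
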